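import Summits.QuantumFields.Balaban3D.Proofs.MassesAC

/-!
# BalabanUVNodes ∕ N08 — THE a.e. REDUCTION OF THE MASS BOUND: print's iterated AC history masses `MassesAC.massRecAC` are DOMINATED, `dV`-almost everywhere, by
# `1 +` the density of ANY one-step-closed family of measures — the kernel form of part (a) of the located note «the load point of E6′»

Track A, DAG node N08 = T. Bałaban, CMP **102** (1985) 255–275 [Balaban1985UV3]: (41) p. 266 (the history masses «Σ_{{Ω_j}} ∫dV_{k−1}↾_{Z_{k−1}} δ(V̄_{k−1}V^{−1}) ⋯ χζ ⋯»),
(48) p. 268; the averaging (2) = [Balaban1985Averaging] (15) p. 19, the transformation (10) p. 19.  Cell `pub-ymgap`, width seat `pub-ymgap-dag-n08-w1` (g3), W-SEAT-START-LIST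
§n08 item 1 successor piece (o10) = file 16; `--supports` K1⁷ `StabilityBAtRecordR13SepCoPH` (helper).  Companion of file 15 `…N08SlotOfRecordFromAlphaACMassBound` ((R4⁗): the
slot of record `Node00.PrintedUV3V N L` from the (α)-AC rows + a POINTWISE extensive bound `hmass` on the AC tower's masses — which at the lane's AC inputs ARE the `rnDeriv`
versions `massRecAC … (avOfPrint N S)`; the file's VERSION CAVEAT splits the located input into (a) an a.e. ANALYTIC bound and (b) a capped carrier).  THIS FILE makes (a)
precise and proves its reduction.

WHAT THIS FILE PROVES (kernel; theorems only, 0 def; [folklore] measure theory about the lane's DEFINED objects `MassesAC.massRecAC`, `AveragingRT.rnTransport`, `Carriers.AvgAC`;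
nothing of the paper asserted).  For ANY averaging family `av` with `AvgAC` at every level (measurable, `Ū_*(dU) ≪ dV` — a THEOREM for (15): `B10Eq2HaarCompatibility`), ANY
thresholds, and ANY family of measures `ν k` on the level-`k` fields with the ONE-STEP CLOSURE `(dU_k + ν_k).map Ū_k ≤ ν_{k+1}`:
* §1 `rnDeriv_le_of_le_withDensity` — `μ ≤ ν.withDensity g ⇒ dμ∕dν ≤ g` ν-a.e. (Mathlib's `rnDeriv_le_one_of_le` with a density).
* §2 ★★ `pushDensity_le_of_withDensity_le` (one transport step: `(f·dU).map Ū ≤ (m·dU).map Ū ≤ …` for `0 ≤ f ≤ m`) and ★★★ `withDensity_massRecAC_le` — **MEASURE FORM: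
  `m_k(h,·)·dU_k ≤ dU_k + ν_k` for every level and history** (induction over the three cases of `massRecAC`: inadmissible `0`; admissible non-trivial = the exact transport
  `toReal ∘ d(Ū_k)_*(w_k m_k dU_k)∕dV` (`w_k ≤ 1`, `Measure.map_mono`, `withDensity_rnDeriv_eq` under `AvgAC`); trivial = `max 1 (…)` — the FLOOR AT `1` is what forces the
  summand `dU_k`, i.e. every composition depth).
* §3 ★★★ `massRecAC_le_ae_of_closed` — **a.e. FORM: `ν_k ≤ dU_k.withDensity B_k ⇒ m_k(h,·) ≤ 1 + B_k` `dU_k`-a.e.** (`ℝ≥0∞`, any `B_k`), `massRecAC_le_ae_of_closed_real` (real `b_k ≥ 0`),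
  and ★★★ `massRecAC_le_exp_ae_of_closed` — **THE EXTENSIVE COROLLARY: `ν_k ≤ (e^{c_k} − 1)·dU_k ⇒ m_k(h,·) ≤ e^{c_k}` a.e.** — with `c_k = c_m·|T₁^{(k)}|` the a.e. form of
  file 15's `hmass`.

LOCATED READING (count-neutral; the owners decide): part (a) of `N08-E6PRIME-LOAD-POINT.md` IS NOW A KERNEL REDUCTION — the analytic input left for the slot of record at
print's own averaging is to EXHIBIT a one-step-closed family `ν` with `ν_k ≤ (e^{c|T₁^{(k)}|} − 1)·dU_k`; the canonical candidate `ν_k := Σ_{j<k} (Ū_{k−1}∘⋯∘Ū_j)_* dU_j`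
(closure with EQUALITY) turns this into «`Σ_{j≤k} d((Ū^{(j→k)})_* dU_j)∕dV_k ≤ e^{c|T₁^{(k)}|}` dV_k-a.e.» — an extensive TARGET-LEVEL density bound for the COMPOSED averagings
of (15), every depth; `c = 0` at depth one would be Haar compatibility a.e.  Part (b) (a capped AC mass carrier, so that a pointwise letter holds by definition) is untouched.

HONEST FRAMING: count-neutral helper; no `ν` is exhibited for (15) — (a) stays OPEN; N08 NOT discharged; one finite 𝕋⁴ programme at fixed ε, Bałaban AS PRINTED — R4 closes
the conditional finite-𝕋⁴ rung `BalabanLadder.UV` only; the Yang–Mills mass gap (Clay) is NOT proved by any of this; nothing continuum ∕ ℝ⁴ ∕ OS.  No `sorry`, standard axioms.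
-/

noncomputable section

open MeasureTheory
open scoped ENNReal

namespace Summit.QuantumFields.YangMills.BalabanUVNodes.N08MassesACDominated

open Literature.MathematicalPhysics.QuantumFieldTheory.Balaban1983to89
open Literature.MathematicalPhysics.QuantumFieldTheory.Balaban1983to89.AveragingRT (rnTransport rnDensity pushDensity rnTransport_nonneg)
open Summit.QuantumFields.Balaban3D.Carriers
open Summit.QuantumFields.Balaban3D.Proofs.MassesAC

/-! ## §1 A Radon–Nikodym comparison lemma -/
section RN

variable {α : Type*} [MeasurableSpace α] {μ ν : Measure α}

/-- **`μ ≤ ν.withDensity g ⇒ dμ∕dν ≤ g` ν-a.e.** (Mathlib's `Measure.rnDeriv_le_one_of_le` with a density `g`). [folklore] -/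
theorem rnDeriv_le_of_le_withDensity [SigmaFinite ν] {g : α → ℝ≥0∞} (h : μ ≤ ν.withDensity g) :
    μ.rnDeriv ν ≤ᵐ[ν] g := by
  refine ae_le_of_forall_setLIntegral_le_of_sigmaFinite (μ.measurable_rnDeriv ν) fun s hs _ => ?_
  calc ∫⁻ x in s, μ.rnDeriv ν x ∂ν ≤ μ s := Measure.setLIntegral_rnDeriv_le s
    _ ≤ ν.withDensity g s := Measure.le_iff'.1 h s
    _ = ∫⁻ x in s, g x ∂ν := withDensity_apply g hs

end RN

/-! ## §2 The measure form: `m_k(h,·)·dU_k ≤ dU_k + ν_k` for every one-step-closed family `ν` -/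
section MeasureForm

variable {P : Params} {G : Type} [GaugeGroup G] [MeasurableSpace G] [HaarData G]

/-- **ONE TRANSPORT STEP IN MEASURE FORM**: for `0 ≤ f ≤ m` pointwise with `m` measurable and `m·dU ≤ dU + ν`, and a measurable averaging `Ū`,
`Ū_*(f·dU) ≤ (dU + ν).map Ū` (`withDensity_mono`, `Measure.map_mono`).  (`AveragingRT.pushDensity Ū f = Ū_*(f⁺·dU)`.) [folklore] -/
theorem pushDensity_le_of_withDensity_le {j : ℕ} {avg : GaugeField P j G → GaugeField P (j + 1) G} (havg : Measurable avg)
    {f m : GaugeField P j G → ℝ} (hfm : ∀ U, f U ≤ m U) {ν : Measure (GaugeField P j G)}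
    (hm : (fieldMeasure P j G).withDensity (fun U => ENNReal.ofReal (m U)) ≤ fieldMeasure P j G + ν) :
    pushDensity avg f ≤ (fieldMeasure P j G + ν).map avg := by
  unfold pushDensity
  refine Measure.map_mono ?_ havg
  exact (withDensity_mono (Filter.Eventually.of_forall fun U => ENNReal.ofReal_le_ofReal (hfm U))).trans hm

variable (M₁ : ℕ) (Rcol : ℕ → ℕ) (εL εS : ℕ → ℝ) (av : ∀ j, Averaging P j G) (hav : ∀ j, AvgAC (av j).avg)
include hav

/-- **THE EXACT TRANSPORT OF A DOMINATED DENSITY IS DOMINATED, IN MEASURE FORM**: if `0 ≤ f ≤ m`, `m·dU_k ≤ dU_k + ν_k` and `(dU_k + ν_k).map Ū_k ≤ ν_{k+1}`, then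
`(T_k f)·dV ≤ ν_{k+1}` for the lane's `T_k = AveragingRT.rnTransport Ū_k` (`= toReal ∘ d(Ū_k)_*(f dU)∕dV`, a.e. equal to the push-forward density under `AvgAC`:
`Measure.withDensity_rnDeriv_le`, `ENNReal.ofReal_toReal_le` — not even `AvgAC`'s absolute continuity is needed here, only measurability of `Ū`). [cite: Balaban1985Averaging, (10) p.19 (the transformation; bookkeeping)] -/
theorem withDensity_rnTransport_le (k : ℕ) {f m : GaugeField P k G → ℝ} (hf0 : ∀ U, 0 ≤ f U) (hfm : ∀ U, f U ≤ m U)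
    {νk : Measure (GaugeField P k G)} {νk1 : Measure (GaugeField P (k + 1) G)}
    (hm : (fieldMeasure P k G).withDensity (fun U => ENNReal.ofReal (m U)) ≤ fieldMeasure P k G + νk)
    (hstep : (fieldMeasure P k G + νk).map (av k).avg ≤ νk1) :
    (fieldMeasure P (k + 1) G).withDensity (fun V => ENNReal.ofReal (rnTransport (av k).avg f V)) ≤ νk1 := by
  have havg : Measurable (av k).avg := (hav k).1
  -- the push-forward `Ū_*(f dU)` is dominated by `ν_{k+1}`
  have hpush : pushDensity (av k).avg f ≤ νk1 := (pushDensity_le_of_withDensity_le havg hfm hm).trans hstep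
  -- `rnTransport f = toReal ∘ rnDeriv (pushDensity f)` for `f ≥ 0`, and `ofReal ∘ toReal ≤ id`
  have hT : ∀ V, ENNReal.ofReal (rnTransport (av k).avg f V) ≤ (pushDensity (av k).avg f).rnDeriv (fieldMeasure P (k + 1) G) V := by
    intro V
    have : rnTransport (av k).avg f V = rnDensity (av k).avg f V := by
      simp only [rnTransport, if_pos hf0]
    rw [this]
    exact ENNReal.ofReal_toReal_le
  calc (fieldMeasure P (k + 1) G).withDensity (fun V => ENNReal.ofReal (rnTransport (av k).avg f V))
      ≤ (fieldMeasure P (k + 1) G).withDensity ((pushDensity (av k).avg f).rnDeriv (fieldMeasure P (k + 1) G)) :=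
        withDensity_mono (Filter.Eventually.of_forall hT)
    _ ≤ pushDensity (av k).avg f := Measure.withDensity_rnDeriv_le _ _
    _ ≤ νk1 := hpush

open Classical in
/-- ★★★ **THE ITERATED AC MASSES IN MEASURE FORM: `m_k(h,·)·dU_k ≤ dU_k + ν_k`** for every level `k` and history `h`, for ANY family of measures `ν` with the ONE-STEP
CLOSURE `(dU_k + ν_k).map Ū_k ≤ ν_{k+1}` (induction over `massRecAC`: `m_0 = 1`; inadmissible `0`; admissible non-trivial = the exact transport of `w_k·m_k(proj h)` with
`0 ≤ w_k ≤ 1` (`Carriers.Masses.stepWeight_nonneg∕_le_one`); trivial = `max 1 (T_k[…]) ≤ 1 + T_k[…]` — the floor at `1` is the source of the summand `dU_k`).  No Haar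
compatibility anywhere (of `AvgAC` only the measurability of `Ū` is used). [cite: Balaban1985UV3, (41) p.266 + (48) p.268 (the masses; bookkeeping)] -/
theorem withDensity_massRecAC_le (ν : ∀ k, Measure (GaugeField P k G))
    (hstep : ∀ k, (fieldMeasure P k G + ν k).map (av k).avg ≤ ν (k + 1)) :
    ∀ (k : ℕ) (h : Hist P k),
      (fieldMeasure P k G).withDensity (fun V => ENNReal.ofReal (massRecAC M₁ Rcol εL εS av k h V)) ≤ fieldMeasure P k G + ν k := by
  intro k
  induction k with
  | zero =>
    intro h
    have h1 : (fun V => ENNReal.ofReal (massRecAC M₁ Rcol εL εS av 0 h V)) = fun _ => (1 : ℝ≥0∞) := by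
      funext V; rw [massRecAC_zero]; simp
    rw [h1]
    calc (fieldMeasure P 0 G).withDensity (fun _ => (1 : ℝ≥0∞)) = fieldMeasure P 0 G := withDensity_one
      _ ≤ fieldMeasure P 0 G + ν 0 := Measure.le_add_right le_rfl
  | succ k ih =>
    intro h
    -- the integrand of the step: `w_k(h)·m_k(proj h)`, between `0` and `m_k(proj h)`
    have hf0 : ∀ U, 0 ≤ stepWeight M₁ Rcol εL εS k h U * massRecAC M₁ Rcol εL εS av k h.proj U := fun U =>
      mul_nonneg (stepWeight_nonneg M₁ Rcol εL εS k h U) (massRecAC_nonneg M₁ Rcol εL εS av k _ U)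
    have hfm : ∀ U, stepWeight M₁ Rcol εL εS k h U * massRecAC M₁ Rcol εL εS av k h.proj U ≤ massRecAC M₁ Rcol εL εS av k h.proj U :=
      fun U => by
        have hw := stepWeight_le_one M₁ Rcol εL εS k h U
        have hm := massRecAC_nonneg M₁ Rcol εL εS av k h.proj U
        nlinarith [stepWeight_nonneg M₁ Rcol εL εS k h U]
    have hT := withDensity_rnTransport_le av hav k hf0 hfm (ih h.proj) (hstep k)
    by_cases ht : h = Hist.triv P (k + 1)
    · -- trivial history: `max 1 (T[…]) ≤ 1 + T[…]`
      subst ht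
      have hle : ∀ V, ENNReal.ofReal (massRecAC M₁ Rcol εL εS av (k + 1) (Hist.triv P (k + 1)) V) ≤
          1 + ENNReal.ofReal (rnTransport (av k).avg
            (fun U => stepWeight M₁ Rcol εL εS k (Hist.triv P (k + 1)) U * massRecAC M₁ Rcol εL εS av k (Hist.triv P (k + 1)).proj U) V) := by
        intro V
        rw [massRecAC_triv_succ, Hist.proj_triv]
        have h0 : 0 ≤ rnTransport (av k).avg
            (fun U => stepWeight M₁ Rcol εL εS k (Hist.triv P (k + 1)) U * massRecAC M₁ Rcol εL εS av k (Hist.triv P k) U) V :=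
          rnTransport_nonneg _ _ (fun U => mul_nonneg (stepWeight_nonneg M₁ Rcol εL εS k _ U) (massRecAC_nonneg M₁ Rcol εL εS av k _ U)) V
        rw [← ENNReal.ofReal_one, ← ENNReal.ofReal_add zero_le_one h0]
        exact ENNReal.ofReal_le_ofReal (max_le (by linarith) (by linarith))
      have hT' := hT
      rw [Hist.proj_triv] at hT' hle
      calc (fieldMeasure P (k + 1) G).withDensity (fun V => ENNReal.ofReal (massRecAC M₁ Rcol εL εS av (k + 1) (Hist.triv P (k + 1)) V))
          ≤ (fieldMeasure P (k + 1) G).withDensity ((fun _ => (1 : ℝ≥0∞)) + fun V => ENNReal.ofReal (rnTransport (av k).avg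
              (fun U => stepWeight M₁ Rcol εL εS k (Hist.triv P (k + 1)) U * massRecAC M₁ Rcol εL εS av k (Hist.triv P k) U) V)) :=
            withDensity_mono (Filter.Eventually.of_forall hle)
        _ = (fieldMeasure P (k + 1) G).withDensity (fun _ => (1 : ℝ≥0∞)) + (fieldMeasure P (k + 1) G).withDensity (fun V =>
              ENNReal.ofReal (rnTransport (av k).avg
                (fun U => stepWeight M₁ Rcol εL εS k (Hist.triv P (k + 1)) U * massRecAC M₁ Rcol εL εS av k (Hist.triv P k) U) V)) :=
            withDensity_add_left measurable_const _
        _ ≤ fieldMeasure P (k + 1) G + ν (k + 1) := by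
            rw [withDensity_const, one_smul]
            exact add_le_add le_rfl hT'
    · by_cases hh : Hist.Admissible M₁ Rcol (k + 1) h
      · -- admissible non-trivial: the exact transport
        have heq : (fun V => ENNReal.ofReal (massRecAC M₁ Rcol εL εS av (k + 1) h V)) = fun V => ENNReal.ofReal (rnTransport (av k).avg
            (fun U => stepWeight M₁ Rcol εL εS k h U * massRecAC M₁ Rcol εL εS av k h.proj U) V) := by
          funext V; rw [massRecAC_succ M₁ Rcol εL εS av k h hh ht V]
        rw [heq]
        exact hT.trans (Measure.le_add_left le_rfl)
      · -- inadmissible: mass `0`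
        have heq : (fun V => ENNReal.ofReal (massRecAC M₁ Rcol εL εS av (k + 1) h V)) = fun _ => (0 : ℝ≥0∞) := by
          funext V; rw [massRecAC_eq_zero_of_not_admissible M₁ Rcol εL εS av (k + 1) h V hh]; simp
        rw [heq, withDensity_const, zero_smul]
        exact bot_le

end MeasureForm

/-! ## §3 The a.e. form and the extensive corollary -/
section AEForm

variable {P : Params} {G : Type} [GaugeGroup G] [MeasurableSpace G] [HaarData G]
  (M₁ : ℕ) (Rcol : ℕ → ℕ) (εL εS : ℕ → ℝ) (av : ∀ j, Averaging P j G) (hav : ∀ j, AvgAC (av j).avg)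
include hav

/-- ★★★ **a.e. FORM: the iterated AC masses are dominated by `1 +` the density of any one-step-closed family** — if moreover `ν_k ≤ dU_k.withDensity B_k` (`B_k` any
`ℝ≥0∞`-valued function) then `m_k(h,·) ≤ 1 + B_k` `dU_k`-a.e. (in `ℝ≥0∞`: `ofReal (m_k(h,V)) ≤ 1 + B_k V`), every level and history (§2 + `rnDeriv_withDensity` + §1).
[cite: Balaban1985UV3, (41) p.266 (the masses; bookkeeping)] -/
theorem massRecAC_le_ae_of_closed (ν : ∀ k, Measure (GaugeField P k G))
    (hstep : ∀ k, (fieldMeasure P k G + ν k).map (av k).avg ≤ ν (k + 1))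
    (B : ∀ k, GaugeField P k G → ℝ≥0∞) (hνB : ∀ k, ν k ≤ (fieldMeasure P k G).withDensity (B k))
    (k : ℕ) (h : Hist P k) :
    ∀ᵐ V ∂(fieldMeasure P k G), ENNReal.ofReal (massRecAC M₁ Rcol εL εS av k h V) ≤ 1 + B k V := by
  have hmeas : Measurable fun V => ENNReal.ofReal (massRecAC M₁ Rcol εL εS av k h V) :=
    (measurable_massRecAC M₁ Rcol εL εS av k h).ennreal_ofReal
  -- measure form, against the density `1 + B_k`
  have hle : (fieldMeasure P k G).withDensity (fun V => ENNReal.ofReal (massRecAC M₁ Rcol εL εS av k h V)) ≤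
      (fieldMeasure P k G).withDensity ((fun _ => (1 : ℝ≥0∞)) + B k) := by
    calc (fieldMeasure P k G).withDensity (fun V => ENNReal.ofReal (massRecAC M₁ Rcol εL εS av k h V))
        ≤ fieldMeasure P k G + ν k := withDensity_massRecAC_le M₁ Rcol εL εS av hav ν hstep k h
      _ ≤ (fieldMeasure P k G).withDensity (fun _ => (1 : ℝ≥0∞)) + (fieldMeasure P k G).withDensity (B k) := by
          rw [withDensity_const, one_smul]; exact add_le_add le_rfl (hνB k)
      _ = (fieldMeasure P k G).withDensity ((fun _ => (1 : ℝ≥0∞)) + B k) := (withDensity_add_left measurable_const _).symm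
  have h1 := rnDeriv_le_of_le_withDensity hle
  have h2 := Measure.rnDeriv_withDensity (fieldMeasure P k G) hmeas
  filter_upwards [h1, h2] with V hV1 hV2
  rw [← hV2]
  exact hV1

/-- **… real form**: with `b_k ≥ 0` real measurable and `ν_k ≤ dU_k.withDensity (ofReal ∘ b_k)`, `m_k(h,V) ≤ 1 + b_k V` for `dU_k`-a.e. `V`. [folklore] -/
theorem massRecAC_le_ae_of_closed_real (ν : ∀ k, Measure (GaugeField P k G))
    (hstep : ∀ k, (fieldMeasure P k G + ν k).map (av k).avg ≤ ν (k + 1))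
    (b : ∀ k, GaugeField P k G → ℝ) (hb0 : ∀ k V, 0 ≤ b k V)
    (hνb : ∀ k, ν k ≤ (fieldMeasure P k G).withDensity (fun V => ENNReal.ofReal (b k V))) (k : ℕ) (h : Hist P k) :
    ∀ᵐ V ∂(fieldMeasure P k G), massRecAC M₁ Rcol εL εS av k h V ≤ 1 + b k V := by
  filter_upwards [massRecAC_le_ae_of_closed M₁ Rcol εL εS av hav ν hstep (fun k V => ENNReal.ofReal (b k V)) hνb k h] with V hV
  rw [← ENNReal.ofReal_one, ← ENNReal.ofReal_add zero_le_one (hb0 k V)] at hV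
  exact (ENNReal.ofReal_le_ofReal_iff (by linarith [hb0 k V])).1 hV

/-- ★★★ **THE EXTENSIVE COROLLARY — the a.e. form of file 15's `hmass`**: if the one-step-closed family is dominated by the CONSTANT densities `e^{c_k} − 1` (`c_k ≥ 0`;
at the [B10] slot `c_k = c_m·|T₁^{(k)}|`), then `m_k(h,V) ≤ e^{c_k}` for `dU_k`-a.e. `V`, every level and history.  With the canonical `ν_k := Σ_{j<k} (Ū_{k−1}∘⋯∘Ū_j)_* dU_j`
(closure with equality) the hypothesis reads «`Σ_{j≤k} d((Ū^{(j→k)})_* dU_j)∕dV_k ≤ e^{c_k}` a.e.» — the target-level density bound for the COMPOSED averagings, every depth.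
[cite: Balaban1985UV3, (41) p.266 + (5) p.256 (the extensive shape); Balaban1985Averaging, (15) p.19] -/
theorem massRecAC_le_exp_ae_of_closed (ν : ∀ k, Measure (GaugeField P k G))
    (hstep : ∀ k, (fieldMeasure P k G + ν k).map (av k).avg ≤ ν (k + 1))
    (c : ℕ → ℝ) (hc : ∀ k, 0 ≤ c k) (hνc : ∀ k, ν k ≤ ENNReal.ofReal (Real.exp (c k) - 1) • fieldMeasure P k G) (k : ℕ) (h : Hist P k) :
    ∀ᵐ V ∂(fieldMeasure P k G), massRecAC M₁ Rcol εL εS av k h V ≤ Real.exp (c k) := by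
  have hb0 : ∀ k, 0 ≤ Real.exp (c k) - 1 := fun k => by linarith [Real.add_one_le_exp (c k), hc k]
  have hνb : ∀ k, ν k ≤ (fieldMeasure P k G).withDensity (fun _ => ENNReal.ofReal (Real.exp (c k) - 1)) := fun k => by
    rw [withDensity_const]; exact hνc k
  filter_upwards [massRecAC_le_ae_of_closed_real M₁ Rcol εL εS av hav ν hstep (fun k _ => Real.exp (c k) - 1)
    (fun k _ => hb0 k) hνb k h] with V hV
  linarith

end AEForm

end Summit.QuantumFields.YangMills.BalabanUVNodes.N08MassesACDominated

end
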